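import Literature.Analysis.FluidPDE.Ferrari1993PressureEstimateProofs
import HarnessLib

/-!
# `Ferrari1993_periodicCylinderHsEnergyInequality` discharged

Topic `Literature/Analysis/FluidPDE`. Discharge file for the named fact
`Literature.Analysis.FluidPDE.Ferrari1993_periodicCylinderHsEnergyInequality` (`Ferrari1993H3Bound.lean`):
Ferrari's `H^s` energy inequality (13)–(14), p. 281 of A. B. Ferrari, *On the blow-up of solutions
of the 3-D Euler equations in a bounded domain*, Comm. Math. Phys. **155** (1993), in the smooth
periodic class on the periodic cylinder `{r < 1} × ℝ/Lℤ` (case `s = 3`).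

Both analytic inputs of its printed proof are theorems of the tree:

* Lemma 1 ii) (the Moser-type calculus inequality, p. 280):
  `Ferrari1993_periodicCylinderMoserInequality_holds` (`Ferrari1993MoserInequality.lean`), which
  gives the commutator estimate and the reduction
  `Ferrari1993_periodicCylinderHsEnergyInequality_of_pressure : PressureEstimate → HsEnergyInequality`
  (the `D^α`-energy method (8)–(13) being proved in `Ferrari1993EnergyIdentity.lean` and
  `Ferrari1993EnergyInequalityReduction.lean`);
* Lemma 2 (the pressure estimate `|∇p|_{H^s} ≤ C |u|_{W^{1,∞}} |u|_{H^s}`, pp. 280–281):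
  `Ferrari1993_periodicCylinderPressureEstimate_holds` (`Ferrari1993PressureEstimateProofs.lean`).

The discharge cannot live in `Ferrari1993H3Bound.lean` itself (the pressure proofs import it), so
it is recorded here, downstream of both. Nothing in this file is a new definition or named fact.

## Review record (D-0026 split review, second pass) for `Ferrari1993_periodicCylinderContinuation`

The named fact `Ferrari1993_periodicCylinderContinuation` (`ChenHouContinuationProofs.lean`) was
checked once more against the held text (Ferrari 1993, Thm 2 p. 279 and the continuation argument
pp. 282–283; Kato–Lai 1984, Thms I–II p. 17): it is the contrapositive of Thm 2 in its weakest
printed form together with the Thm 1 restart, rendered in the smooth axisymmetric periodic class of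
its parent `Ferrari1993_periodicCylinderEulerBKM` — one distinct printed theorem, faithfully stated,
neither open nor mis-stated, and kept as a named fact (unlike the retired sibling rendering of
Kato–Lai Thm I/II, it does not duplicate another fact). Its discharge needs **no further named
fact**: with this file the in-tree reduction reads

* `Ferrari1993_periodicCylinderContinuation` ⇐ `Ferrari1993_periodicCylinderH3Bound` +
  `KatoLai1984_periodicCylinderUniformExistence` (+ uniqueness, discharged) —
  `Ferrari1993_periodicCylinderContinuation_of_H3Bound_of_uniformExistence`;
* `Ferrari1993_periodicCylinderH3Bound` ⇐ `ShirotaYanagisawa1993_periodicCylinderLogEstimate` alone —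
  `Ferrari1993_periodicCylinderH3Bound_of_logEstimate` below (energy inequality discharged here);
* `ShirotaYanagisawa1993_periodicCylinderLogEstimate` ⇐
  `ShirotaYanagisawa1993_periodicCylinderLogDivCurlEstimate`, the stationary logarithmic div–curl
  estimate for one field (Ferrari's Cor. 1 (31) p. 286 / Shirota–Yanagisawa (15) p. 80 before the
  energy inequality is invoked) — `ShirotaYanagisawa1993_periodicCylinderLogEstimate_of_divCurl`
  (`Ferrari1993LogEstimateReduction.lean`). This is the chain's single elliptic leaf: its former
  decomposition descendants (the `δ`-families, Ferrari's Prop. 1 (30), Ferrari's global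
  `δ`-estimate (71), the Green-matrix fact) were merged back by their split reviews as equivalent
  or stronger rewordings of it (records in `PeriodicCylinderLogDivCurl.lean`,
  `Ferrari1993Prop1LogEstimate.lean`, `Ferrari1993Prop1DeltaFamily.lean`,
  `PeriodicCylinderGreenMatrix.lean`),

so that `Ferrari1993_periodicCylinderContinuation_holds` is the term
`Ferrari1993_periodicCylinderContinuation_of_logDivCurl_of_uniformExistence B_holds E_holds`
(`Ferrari1993ContinuationLeaves.lean`) as soon as the two leaves
`B = ShirotaYanagisawa1993_periodicCylinderLogDivCurlEstimate` and
`E = KatoLai1984_periodicCylinderUniformExistence` are discharged; whoever discharges the later of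
the two should land that one-line discharge (and `Ferrari1993_periodicCylinderEulerBKM` via
`Ferrari1993_periodicCylinderEulerBKM_of_logDivCurl_of_uniformExistence`) in a downstream
`…Holds.lean` file in the same change.
-/

noncomputable section

namespace Literature.Analysis.FluidPDE

/-- **Ferrari (1993), (13)–(14), discharged**: the `H³` energy inequality
`‖u(t)‖_{H³(cell)} ≤ ‖u₀‖_{H³(cell)} exp(C ∫₀ᵗ ‖u‖_{W^{1,∞}(cell)})` for smooth periodic Euler
solutions in the periodic cylinder holds — Lemma 1 ii) and Lemma 2 being theorems of the tree
(`Ferrari1993_periodicCylinderHsEnergyInequality_of_pressure` fed with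
`Ferrari1993_periodicCylinderPressureEstimate_holds`). [cite: Ferrari1993, (13)–(14) p. 281 with Lemmas 1–2 pp. 280–281] -/
theorem Ferrari1993_periodicCylinderHsEnergyInequality_holds :
    Ferrari1993_periodicCylinderHsEnergyInequality :=
  Ferrari1993_periodicCylinderHsEnergyInequality_of_pressure
    Ferrari1993_periodicCylinderPressureEstimate_holds

/-- **The a-priori `H³` bound (7) = (17) on the logarithmic estimate alone**: with the energy
inequality discharged, `Ferrari1993_periodicCylinderH3Bound` rests on the single named fact
`ShirotaYanagisawa1993_periodicCylinderLogEstimate` (Gronwall step: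
`Ferrari1993_periodicCylinderH3Bound_of_energyInequality_of_logEstimate`,
`Ferrari1993H3BoundRegularity.lean`). [cite: Ferrari1993, §1 proof of Thm 2, (4) ⇒ (7) = (17) (pp. 279–282)] -/
theorem Ferrari1993_periodicCylinderH3Bound_of_logEstimate
    (hB : ShirotaYanagisawa1993_periodicCylinderLogEstimate) :
    Ferrari1993_periodicCylinderH3Bound :=
  Ferrari1993_periodicCylinderH3Bound_of_energyInequality_of_logEstimate
    Ferrari1993_periodicCylinderHsEnergyInequality_holds hB

end Literature.Analysis.FluidPDE
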